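/-
Origin: expansion seat `planner-pub-hodgecm-pv14-g3-0`, handover #1 2026-08-18T05:25:39Z (`HOME/pub-hodgecm-pv14-g3/lean/Pv14g3/PerL34/P43KTypesU2.lean`, md5 14eefeaa, 368 lines);
landed by the gen-6 packager in gate run 23 as `HodgeCM/PerL34/P43_KTypesU2.lean` (verbatim).
-/
/-
Origin: HOME/pub-hodgecm-pv14-g3/lean/Pv14g3/PerL34/P43KTypesU2.lean — session planner-pub-hodgecm-pv14-g3-0 (unit
pub-hodgecm-pv14-g3, DAG-NODE PROVER #14 gen 3; successor of pv14 / pv14-g2).  Intended final place: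
`HodgeCM/PerL34/P43_KTypesU2.lean`, companion of `P43_KTypes.lean` (run 20) and `P43_X1bridge.lean` (run 22).
DAG node **N33b** (PerL v5 Prop 4.3 proof, step (C1) = input (X1), tex ll. 650–652).  Imports `Mathlib` only;
nothing cited, nothing asserted: the CONCRETE `K_{ι₁}`-module algebra behind the Schur leaves of the X1 bridge.
-/
import Mathlib

set_option autoImplicit false

/-!
# N33b (X1), concrete `K_{ι₁}`-types: `F_{0,0}` and `F_{1,1}` are IRREDUCIBLE (kernel)

`P43_X1bridge.thetaPKilledByPminus_of_KTypes` derives the N33b binder (X1) `ThetaPKilledByPminus` ("`Θ_i(χ'_i)[𝔭₊]`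
is killed by `𝔭₋`", tex ll. 650–652) from Schur's lemma over an ARBITRARY ring `R`, with the representation theory
of `K_{ι₁}` entering through labelled leaves: the typeclass leaves `[IsSimpleModule R M₀] [IsSimpleModule R M₁]`
(irreducibility of the two `K_{ι₁}`-types `F_{0,0}`, `F_{1,1}` of `Λ^{1,1} = 𝔭₋ ⊗ 𝔭₊`, [BW VI 4.9(1),(2)] for
`n = 2`, `p = q = 1`), `hgen` (PRINT, same source + complete reducibility), `h₀ h₁` (PRINT [BW VI 4.11/(9)] + INPUT
N31) and the DEFINITIONAL dictionary `hdict`/`hCoch`.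

This file makes the first group of leaves KERNEL for the group that actually occurs, `K_{ι₁} = U(2) × U(1) ⊂ U(2,1)`
(tex l. 652–654: the `τ`-valued function on `U(V_{3,ι₁}) ≅ U(2,1)`; `K_{ι₁}` = its maximal compact):
* `K`        : the compact group `U(2) × U(1)` (`Matrix.unitaryGroup (Fin 2) ℂ × unitary ℂ`);
* `conjRep`  : the `K`-module `M₂(ℂ) ≅ End(𝔭₊) ≅ 𝔭₋ ⊗ 𝔭₊ = Λ^{1,1}`, `(A,d)·X = A X A*`
               (for `𝔭₊ ≅ ℂ²` with `(A,d)·v = d⁻¹Av` and `𝔭₋ =` its contragredient the `d`-twists cancel);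
* `F11`      : the sub-`K`-module `sl₂(ℂ) = {tr X = 0}` (= `F_{1,1}`, the adjoint `K`-type), `F00` : the trivial
               `K`-type `F_{0,0}` (= the line `ℂ·1 ⊂ M₂(ℂ)`, here `Representation.trivial ℂ K ℂ`);
* `instF11Irreducible`, `instF00Irreducible` : both are IRREDUCIBLE (`Representation.IsIrreducible`), hence
  (Mathlib: `irreducible_iff_isSimpleModule_asModule`) `isSimpleModule_F11/F00 : IsSimpleModule ℂ[K] Fᵢ.asModule` —
  exactly the typeclass leaves of the X1 bridge for `R = ℂ[K] = MonoidAlgebra ℂ K`, `M₀ = F00.asModule`,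
  `M₁ = F11.asModule`.
The irreducibility of `F_{1,1}` is proved by hand (no highest-weight theory): conjugation by the torus element
`t = (diag(i,1), 1)` splits any element `aH + bE + cF` of a `K`-stable subspace `S` into `aH, bE, cF ∈ S`
(`split_mem`), and conjugation by the rational rotation `r = ((3,-4),(4,3))/5` moves each of `H, E, F` to a vector with
the other two coordinates non-zero (`F11_r_H/E/F`), so a non-zero `S` contains `H, E, F`, i.e. `S = ⊤`.

What this changes in the N33b cone (GAPS `## pub-hodgecm-pv14-g2` A1, item (D-X1)): the simplicity leaves become
KERNEL for the concrete `K_{ι₁}`; `hgen`, `h₀ h₁`, `hdict`, `hCoch` are untouched by this file (see the companion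
`P43_KTypesU2Gen.lean` for `hgen`).
-/

noncomputable section

namespace HodgeCM
namespace PerL34
namespace P43KTypesU2

open Matrix Complex

/-- `K_{ι₁} = U(2) × U(1)`, the maximal compact subgroup of `U(2,1)`. -/
abbrev K : Type := (Matrix.unitaryGroup (Fin 2) ℂ) × (unitary ℂ)

/-- The underlying `2 × 2` unitary matrix of `k = (A,d) ∈ K`. -/
abbrev mat (k : K) : Matrix (Fin 2) (Fin 2) ℂ := (k.1 : Matrix (Fin 2) (Fin 2) ℂ)

/-- (Ported verbatim from the HodgeCMPerL package; no docstring in the source.) -/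
theorem mat_mul_star (k : K) : mat k * star (mat k) = 1 :=
  Matrix.mem_unitaryGroup_iff.mp k.1.2

/-- (Ported verbatim from the HodgeCMPerL package; no docstring in the source.) -/
theorem star_mul_mat (k : K) : star (mat k) * mat k = 1 :=
  Matrix.mem_unitaryGroup_iff'.mp k.1.2

/-- `Λ^{1,1} ≅ 𝔭₋ ⊗ 𝔭₊ ≅ End(𝔭₊) = M₂(ℂ)` as a `K`-module: `(A,d)·X = A X A*`. -/
def conjRep : Representation ℂ K (Matrix (Fin 2) (Fin 2) ℂ) where
  toFun k :=
    { toFun := fun X => mat k * X * star (mat k)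
      map_add' := fun X Y => by rw [Matrix.mul_add, Matrix.add_mul]
      map_smul' := fun c X => by rw [Matrix.mul_smul, Matrix.smul_mul, RingHom.id_apply] }
  map_one' := by
    apply LinearMap.ext
    intro X
    simp [mat]
  map_mul' k₁ k₂ := by
    apply LinearMap.ext
    intro X
    simp only [mat, Prod.fst_mul, Submonoid.coe_mul, LinearMap.coe_mk, AddHom.coe_mk, Module.End.mul_apply,
      star_mul, Matrix.mul_assoc]

/-- (Ported verbatim from the HodgeCMPerL package; no docstring in the source.) -/
@[simp] theorem conjRep_apply (k : K) (X : Matrix (Fin 2) (Fin 2) ℂ) :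
    conjRep k X = mat k * X * star (mat k) := rfl

/-- The traceless matrices `sl₂(ℂ) ⊂ M₂(ℂ)` (underlying space of `F_{1,1}`). -/
def V11 : Submodule ℂ (Matrix (Fin 2) (Fin 2) ℂ) := LinearMap.ker (Matrix.traceLinearMap (Fin 2) ℂ ℂ)

/-- (Ported verbatim from the HodgeCMPerL package; no docstring in the source.) -/
theorem mem_V11 {X : Matrix (Fin 2) (Fin 2) ℂ} : X ∈ V11 ↔ X.trace = 0 := by
  simp [V11]

/-- (Ported verbatim from the HodgeCMPerL package; no docstring in the source.) -/
theorem mem_V11' {X : Matrix (Fin 2) (Fin 2) ℂ} : X ∈ V11 ↔ X 0 0 + X 1 1 = 0 := by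
  rw [mem_V11, Matrix.trace_fin_two]

/-- `sl₂(ℂ)` is `K`-stable: `tr (A X A*) = tr (A* A X) = tr X`. -/
def sl2 : Subrepresentation conjRep where
  toSubmodule := V11
  apply_mem_toSubmodule k X hX := by
    rw [mem_V11] at hX ⊢
    rw [conjRep_apply, Matrix.trace_mul_cycle, star_mul_mat, Matrix.one_mul, hX]

/-- `F_{1,1}`: the adjoint `K`-type on `sl₂(ℂ)`. -/
def F11 : Representation ℂ K V11 := sl2.toRepresentation

/-- (Ported verbatim from the HodgeCMPerL package; no docstring in the source.) -/
@[simp] theorem F11_apply_coe (k : K) (v : V11) :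
    ((F11 k v : V11) : Matrix (Fin 2) (Fin 2) ℂ) = mat k * (v : Matrix (Fin 2) (Fin 2) ℂ) * star (mat k) := rfl

/-- `F_{0,0}`: the trivial `K`-type. -/
def F00 : Representation ℂ K ℂ := Representation.trivial ℂ K ℂ

/-! ## The weight basis `H, E, F` of `sl₂(ℂ)` -/

/-- `H = diag(1,-1)`. -/
def H : V11 := ⟨!![1, 0; 0, -1], by rw [mem_V11']; simp⟩
/-- `E = e₁₂`. -/
def E : V11 := ⟨!![0, 1; 0, 0], by rw [mem_V11']; simp⟩
/-- `F = e₂₁`. -/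
def F : V11 := ⟨!![0, 0; 1, 0], by rw [mem_V11']; simp⟩

/-- (Ported verbatim from the HodgeCMPerL package; no docstring in the source.) -/
@[simp] theorem H_coe : (H : Matrix (Fin 2) (Fin 2) ℂ) = !![1, 0; 0, -1] := rfl
/-- (Ported verbatim from the HodgeCMPerL package; no docstring in the source.) -/
@[simp] theorem E_coe : (E : Matrix (Fin 2) (Fin 2) ℂ) = !![0, 1; 0, 0] := rfl
/-- (Ported verbatim from the HodgeCMPerL package; no docstring in the source.) -/
@[simp] theorem F_coe : (F : Matrix (Fin 2) (Fin 2) ℂ) = !![0, 0; 1, 0] := rfl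

/-- (Ported verbatim from the HodgeCMPerL package; no docstring in the source.) -/
theorem comb_coe (a b c : ℂ) : ((a • H + b • E + c • F : V11) : Matrix (Fin 2) (Fin 2) ℂ) = !![a, b; c, -a] := by
  ext i j
  fin_cases i <;> fin_cases j <;> simp

/-- Every traceless matrix is `aH + bE + cF` with `a, b, c` its `(0,0), (0,1), (1,0)` entries. -/
theorem decomp (v : V11) :
    v = (v : Matrix (Fin 2) (Fin 2) ℂ) 0 0 • H + (v : Matrix (Fin 2) (Fin 2) ℂ) 0 1 • E
      + (v : Matrix (Fin 2) (Fin 2) ℂ) 1 0 • F := by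
  have hv := mem_V11'.mp v.2
  apply Subtype.ext
  rw [comb_coe]
  ext i j
  fin_cases i <;> fin_cases j <;> simp
  linear_combination hv

/-- (Ported verbatim from the HodgeCMPerL package; no docstring in the source.) -/
theorem H_ne_zero : (H : V11) ≠ 0 := by
  intro h
  have := congrArg (fun v : V11 => (v : Matrix (Fin 2) (Fin 2) ℂ) 0 0) h
  simp at this

/-! ## Two elements of `K`: the torus element `t = (diag(i,1),1)` and the rotation `r = ((3,-4),(4,3))/5` -/

/-- `diag(i, 1)`. -/
def tM : Matrix (Fin 2) (Fin 2) ℂ := !![I, 0; 0, 1]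
/-- The rational rotation `((3,-4),(4,3))/5 ∈ SO(2) ⊂ U(2)`. -/
def rM : Matrix (Fin 2) (Fin 2) ℂ := !![3/5, -4/5; 4/5, 3/5]

/-- (Ported verbatim from the HodgeCMPerL package; no docstring in the source.) -/
theorem star_tM : star tM = !![-I, 0; 0, 1] := by
  ext i j
  fin_cases i <;> fin_cases j <;> simp [tM, Matrix.star_apply]

/-- (Ported verbatim from the HodgeCMPerL package; no docstring in the source.) -/
theorem star_rM : star rM = !![3/5, 4/5; -4/5, 3/5] := by
  ext i j
  fin_cases i <;> fin_cases j <;> simp [rM, Matrix.star_apply]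

/-- (Ported verbatim from the HodgeCMPerL package; no docstring in the source.) -/
theorem tM_mem : tM ∈ Matrix.unitaryGroup (Fin 2) ℂ := by
  rw [Matrix.mem_unitaryGroup_iff, star_tM, tM]
  ext i j
  fin_cases i <;> fin_cases j <;> simp [Matrix.mul_apply, Fin.sum_univ_two]

/-- (Ported verbatim from the HodgeCMPerL package; no docstring in the source.) -/
theorem rM_mem : rM ∈ Matrix.unitaryGroup (Fin 2) ℂ := by
  rw [Matrix.mem_unitaryGroup_iff, star_rM, rM]
  ext i j
  fin_cases i <;> fin_cases j <;> simp [Matrix.mul_apply, Fin.sum_univ_two] <;> norm_num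

/-- `t = (diag(i,1), 1) ∈ K`. -/
def t : K := (⟨tM, tM_mem⟩, 1)
/-- `r = (((3,-4),(4,3))/5, 1) ∈ K`. -/
def r : K := (⟨rM, rM_mem⟩, 1)

/-- (Ported verbatim from the HodgeCMPerL package; no docstring in the source.) -/
@[simp] theorem mat_t : mat t = tM := rfl
/-- (Ported verbatim from the HodgeCMPerL package; no docstring in the source.) -/
@[simp] theorem mat_r : mat r = rM := rfl

/-- `Ad(t)(aH + bE + cF) = aH + ibE - icF` (the weights `0, 1, -1` of the torus). -/
theorem F11_t (a b c : ℂ) : F11 t (a • H + b • E + c • F) = a • H + (I * b) • E + (-I * c) • F := by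
  apply Subtype.ext
  rw [F11_apply_coe, comb_coe, comb_coe, mat_t, star_tM, tM]
  ext i j
  fin_cases i <;> fin_cases j <;> simp [Matrix.mul_apply, Fin.sum_univ_two]
  · linear_combination (-a) * I_mul_I
  · ring

/-- `Ad(r)` of a general traceless matrix. -/
theorem F11_r (a b c : ℂ) : F11 r (a • H + b • E + c • F) =
    ((-7 * a - 12 * b - 12 * c) / 25) • H + ((24 * a + 9 * b - 16 * c) / 25) • E
      + ((24 * a - 16 * b + 9 * c) / 25) • F := by
  apply Subtype.ext
  rw [F11_apply_coe, comb_coe, comb_coe, mat_r, star_rM, rM]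
  ext i j
  fin_cases i <;> fin_cases j <;> simp [Matrix.mul_apply, Fin.sum_univ_two] <;> ring

/-! ## Irreducibility of `F_{1,1}` -/

section Irreducible

variable (S : Subrepresentation F11)

/-- (Ported verbatim from the HodgeCMPerL package; no docstring in the source.) -/
theorem mem_iff {v : V11} : v ∈ S ↔ v ∈ S.toSubmodule := Iff.rfl

/-- (Ported verbatim from the HodgeCMPerL package; no docstring in the source.) -/
theorem apply_mem {v : V11} (k : K) (hv : v ∈ S.toSubmodule) : F11 k v ∈ S.toSubmodule :=
  S.apply_mem_toSubmodule k hv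

/-- Torus splitting: a `K`-stable subspace containing `aH + bE + cF` contains `aH`, `bE` and `cF`. -/
theorem split_mem {a b c : ℂ} (h : a • H + b • E + c • F ∈ S.toSubmodule) :
    a • H ∈ S.toSubmodule ∧ b • E ∈ S.toSubmodule ∧ c • F ∈ S.toSubmodule := by
  -- z₁ = Ad(t) z, z₂ = Ad(t) z₁
  have h₁ : a • H + (I * b) • E + (-I * c) • F ∈ S.toSubmodule := by
    simpa only [F11_t] using apply_mem S t h
  have e1 : I * (I * b) = -b := by rw [← mul_assoc, I_mul_I, neg_one_mul]
  have s1 : -I * (I * b) = b := by rw [← mul_assoc, neg_mul, I_mul_I, neg_neg, one_mul]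
  have s2 : -I * (-I * c) = -c := by rw [← mul_assoc, neg_mul_neg, I_mul_I, neg_one_mul]
  have h₂ : a • H + (-b) • E + (-c) • F ∈ S.toSubmodule := by
    have := apply_mem S t h₁
    rw [F11_t, e1, s2] at this
    exact this
  have hH : a • H ∈ S.toSubmodule := by
    have := S.toSubmodule.smul_mem (1 / 2 : ℂ) (S.toSubmodule.add_mem h h₂)
    convert this using 1
    module
  have hy : b • E + c • F ∈ S.toSubmodule := by
    have := S.toSubmodule.smul_mem (1 / 2 : ℂ) (S.toSubmodule.sub_mem h h₂)
    convert this using 1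
    module
  have hy₁ : (I * b) • E + (-I * c) • F ∈ S.toSubmodule := by
    have h0 : (0 : ℂ) • H + b • E + c • F ∈ S.toSubmodule := by simpa only [zero_smul, zero_add] using hy
    have := apply_mem S t h0
    rw [F11_t] at this
    simpa only [zero_smul, zero_add] using this
  have hy₂ : b • E + (-c) • F ∈ S.toSubmodule := by
    have := S.toSubmodule.smul_mem (-I) hy₁
    rw [smul_add, smul_smul, smul_smul, s1, s2] at this
    exact this
  have hE : b • E ∈ S.toSubmodule := by
    have := S.toSubmodule.smul_mem (1 / 2 : ℂ) (S.toSubmodule.add_mem hy hy₂)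
    convert this using 1
    module
  have hF : c • F ∈ S.toSubmodule := by
    have := S.toSubmodule.smul_mem (1 / 2 : ℂ) (S.toSubmodule.sub_mem hy hy₂)
    convert this using 1
    module
  exact ⟨hH, hE, hF⟩

/-- (Ported verbatim from the HodgeCMPerL package; no docstring in the source.) -/
theorem mem_of_smul_mem {a : ℂ} (ha : a ≠ 0) {v : V11} (h : a • v ∈ S.toSubmodule) : v ∈ S.toSubmodule := by
  have := S.toSubmodule.smul_mem a⁻¹ h
  rwa [smul_smul, inv_mul_cancel₀ ha, one_smul] at this

/-- (Ported verbatim from the HodgeCMPerL package; no docstring in the source.) -/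
theorem EF_of_H (hH : H ∈ S.toSubmodule) : E ∈ S.toSubmodule ∧ F ∈ S.toSubmodule := by
  have h := apply_mem S r (by simpa only [one_smul, zero_smul, add_zero] using hH :
    (1 : ℂ) • H + (0 : ℂ) • E + (0 : ℂ) • F ∈ _)
  rw [F11_r] at h
  obtain ⟨-, hE, hF⟩ := split_mem S h
  norm_num at hE hF
  exact ⟨mem_of_smul_mem S (by norm_num) hE, mem_of_smul_mem S (by norm_num) hF⟩

/-- (Ported verbatim from the HodgeCMPerL package; no docstring in the source.) -/
theorem HF_of_E (hE : E ∈ S.toSubmodule) : H ∈ S.toSubmodule ∧ F ∈ S.toSubmodule := by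
  have h := apply_mem S r (by simpa only [one_smul, zero_smul, add_zero, zero_add] using hE :
    (0 : ℂ) • H + (1 : ℂ) • E + (0 : ℂ) • F ∈ _)
  rw [F11_r] at h
  obtain ⟨hH, -, hF⟩ := split_mem S h
  norm_num at hH hF
  exact ⟨mem_of_smul_mem S (by norm_num) hH, mem_of_smul_mem S (by norm_num) hF⟩

/-- (Ported verbatim from the HodgeCMPerL package; no docstring in the source.) -/
theorem HE_of_F (hF : F ∈ S.toSubmodule) : H ∈ S.toSubmodule ∧ E ∈ S.toSubmodule := by
  have h := apply_mem S r (by simpa only [one_smul, zero_smul, zero_add] using hF :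
    (0 : ℂ) • H + (0 : ℂ) • E + (1 : ℂ) • F ∈ _)
  rw [F11_r] at h
  obtain ⟨hH, hE, -⟩ := split_mem S h
  norm_num at hH hE
  exact ⟨mem_of_smul_mem S (by norm_num) hH, mem_of_smul_mem S (by norm_num) hE⟩

/-- (Ported verbatim from the HodgeCMPerL package; no docstring in the source.) -/
theorem eq_top_of_HEF (hH : H ∈ S.toSubmodule) (hE : E ∈ S.toSubmodule) (hF : F ∈ S.toSubmodule) : S = ⊤ := by
  apply Subrepresentation.toSubmodule_injective
  change S.toSubmodule = ⊤
  rw [Submodule.eq_top_iff']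
  intro v
  rw [decomp v]
  exact S.toSubmodule.add_mem (S.toSubmodule.add_mem (S.toSubmodule.smul_mem _ hH)
    (S.toSubmodule.smul_mem _ hE)) (S.toSubmodule.smul_mem _ hF)

/-- A non-zero `K`-stable subspace of `sl₂(ℂ)` is everything. -/
theorem eq_top_of_ne_bot (hS : S ≠ ⊥) : S = ⊤ := by
  obtain ⟨v, hvS, hv0⟩ : ∃ v ∈ S.toSubmodule, v ≠ 0 := by
    by_contra hcon
    push Not at hcon
    apply hS
    apply Subrepresentation.toSubmodule_injective
    change S.toSubmodule = ⊥
    rw [Submodule.eq_bot_iff]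
    exact hcon
  set a := (v : Matrix (Fin 2) (Fin 2) ℂ) 0 0
  set b := (v : Matrix (Fin 2) (Fin 2) ℂ) 0 1
  set c := (v : Matrix (Fin 2) (Fin 2) ℂ) 1 0
  have hdec : v = a • H + b • E + c • F := decomp v
  obtain ⟨ha, hb, hc⟩ := split_mem S (a := a) (b := b) (c := c) (hdec ▸ hvS)
  have habc : a ≠ 0 ∨ b ≠ 0 ∨ c ≠ 0 := by
    by_contra hcon
    push Not at hcon
    apply hv0
    rw [hdec, hcon.1, hcon.2.1, hcon.2.2, zero_smul, zero_smul, zero_smul, add_zero, add_zero]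
  rcases habc with ha0 | hb0 | hc0
  · have hH := mem_of_smul_mem S ha0 ha
    obtain ⟨hE, hF⟩ := EF_of_H S hH
    exact eq_top_of_HEF S hH hE hF
  · have hE := mem_of_smul_mem S hb0 hb
    obtain ⟨hH, hF⟩ := HF_of_E S hE
    exact eq_top_of_HEF S hH hE hF
  · have hF := mem_of_smul_mem S hc0 hc
    obtain ⟨hH, hE⟩ := HE_of_F S hF
    exact eq_top_of_HEF S hH hE hF

end Irreducible

/-- **`F_{1,1}` is an irreducible `K_{ι₁}`-module** (kernel; [BW VI 4.9] takes the `F_{p,q}` irreducible). -/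
instance instF11Irreducible : F11.IsIrreducible where
  exists_pair_ne := ⟨⊥, ⊤, by
    intro h
    have hH : (H : V11) ∈ (⊤ : Subrepresentation F11).toSubmodule := Submodule.mem_top
    rw [← h] at hH
    exact H_ne_zero ((Submodule.mem_bot ℂ).mp hH)⟩
  eq_bot_or_eq_top S := by
    by_cases hS : S = ⊥
    · exact Or.inl hS
    · exact Or.inr (eq_top_of_ne_bot S hS)

/-- **`F_{0,0}` (the trivial `K`-type) is irreducible** (one-dimensional). -/
instance instF00Irreducible : F00.IsIrreducible where
  exists_pair_ne := ⟨⊥, ⊤, by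
    intro h
    have h1 : (1 : ℂ) ∈ (⊤ : Subrepresentation F00).toSubmodule := Submodule.mem_top
    rw [← h] at h1
    exact one_ne_zero ((Submodule.mem_bot ℂ).mp h1)⟩
  eq_bot_or_eq_top S := by
    rcases Ideal.eq_bot_or_top (S.toSubmodule : Ideal ℂ) with h | h
    · left
      apply Subrepresentation.toSubmodule_injective
      exact h
    · right
      apply Subrepresentation.toSubmodule_injective
      exact h

/-! ## The typeclass leaves of the X1 bridge, for `R = ℂ[K]` -/

/-- `M₁ = F_{1,1}` is a simple `ℂ[K_{ι₁}]`-module. -/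
theorem isSimpleModule_F11 : IsSimpleModule (MonoidAlgebra ℂ K) F11.asModule := inferInstance

/-- `M₀ = F_{0,0}` is a simple `ℂ[K_{ι₁}]`-module. -/
theorem isSimpleModule_F00 : IsSimpleModule (MonoidAlgebra ℂ K) F00.asModule := inferInstance

/-- `F_{0,0}` and `F_{1,1}` are DIFFERENT `K`-types (no intertwining isomorphism: dimensions `1 ≠ 3` — here simply:
an equivariant iso would be a linear iso `ℂ ≃ V11`, but `H, E` are linearly independent). -/
theorem F00_not_equiv_F11 : IsEmpty (Representation.Equiv F00 F11) := by
  refine ⟨fun e => ?_⟩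
  -- the image of `1` spans `V11` over `ℂ`, so `H` and `E` are both multiples of it: contradiction on entries
  have hsurj := e.toLinearEquiv.surjective
  obtain ⟨x, hx⟩ := hsurj H
  obtain ⟨y, hy⟩ := hsurj E
  have hxy : y • H = x • E := by
    rw [← hx, ← hy, ← map_smul, ← map_smul, smul_eq_mul, smul_eq_mul, mul_comm]
  have h00 := congrArg (fun v : V11 => (v : Matrix (Fin 2) (Fin 2) ℂ) 0 0) hxy
  have hy0 : y = 0 := by simpa using h00
  have hE0 : E = 0 := by rw [← hy, hy0, map_zero]
  have h01 := congrArg (fun v : V11 => (v : Matrix (Fin 2) (Fin 2) ℂ) 0 1) hE0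
  simp at h01

end P43KTypesU2
end PerL34
end HodgeCM

end
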